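import Summits.QuantumFields.YangMills.Theorems.EquipartitionCriticalityFreeEnergyLogCoefficientAbstractC
import HarnessLib

/-!
# The abstract joint limit `n → ∞`, `β → ∞` (Lemma 17.7 and the group-free Theorem 2.1) — crux `FreeEnergyLogCoefficient`, line `Sketch`, stub `abstractJointLimit`

S. Chatterjee, *The leading term of the Yang–Mills free energy*, J. Funct. Anal. 271 (2016),
arXiv:1602.01222, §17, GROUP-FREE, for an abstract one-box interface `B : OneBoxBounds d` (port of
the last part of the tree file
`Literature/MathematicalPhysics/QuantumFieldTheory/ChatterjeeFreeEnergyJointLimit.lean`):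

* `lowB` (**regime B**, special side lengths `n = ρ(m-1)+1`, Theorem 14.3), `lowC` (**regime C**,
  `β^c < n ≤ β³`, rounding up), `descent_junk_le_JD`, `lowD` (**regime D**, `n > β³`, Lemma 17.5);
* `eventually_le_T` (**Lemma 17.7**), `tendsto_T` (the joint limit of `T` given `G(n) → A₀`),
  `tendsto_Gm` (`G(n) → (d-1) log c_H + D L` from `log Z_M(B_n)/n^d → L`);
* `stub_abstractJointLimit` (the registered stub of the skeleton of line `Sketch`):
  `T(B_n, β) → (d-1) log c_H + D L` jointly as `n → ∞`, `β → ∞`.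

## References

* S. Chatterjee, *The leading term of the Yang–Mills free energy*, J. Funct. Anal. 271 (2016)
  2944–3005, arXiv:1602.01222, §17 (Lemmas 17.6, 17.7, proof of Thm. 2.1). [arXiv160201222]
-/

noncomputable section

open scoped Matrix Matrix.Norms.Frobenius ENNReal NNReal
open MeasureTheory Measure Filter Topology Set
open Literature.Probability.LatticeModels Literature.MathematicalPhysics.QuantumLattice
open Literature.MathematicalPhysics.QuantumFieldTheory

namespace Summit.QuantumFields.YangMills.Theorems.FreeEnergyLogCoefficient

namespace OneBoxBounds

open ChatterjeeJointLimit WilsonWeakCoupling LatticeMaxwell ChatterjeeAssembly AxialGauge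

variable {d : ℕ} (B : OneBoxBounds d)

/-- **Regime B (special side length `n = ρ(m-1)+1`, `m ≍ β^b`)**: Theorem 14.3 supplies `L`, and
`T(B_n, β) ≥ G(n) - e₀(β) - err_LB(β)` provided `n ≤ 3β³`. [cite: arXiv160201222, Lemma 17.6] -/
theorem lowB (hd : 1 ≤ d) {β : ℝ} (hβ2 : 2 ≤ β) (hr1 : β ^ (-(2 / 5 : ℝ)) ≤ B.r₁)
    (hN10 : B.ν ≤ β ^ (1 / 10 : ℝ)) (hRb : Rbfun d (bL d) β / β ^ (1 / 10 : ℝ) ≤ 1 / B.ν)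
    (hb4 : 4 ≤ β ^ bL d) {m ρ : ℕ} (hmb : (m : ℝ) ≤ β ^ bL d) (hmb' : β ^ bL d - 1 ≤ m) (hρ : 1 ≤ ρ)
    (hn3 : (fineN m ρ : ℝ) ≤ 3 * β ^ 3) :
    B.Gm (fineN m ρ) - B.e0 β - B.errLB β ≤ B.T (fineN m ρ) β := by
  have hβ0 : 0 < β := by linarith
  have hβ1 : 1 ≤ β := by linarith
  have hN0 : (0 : ℝ) < B.ν := lt_of_lt_of_le one_pos B.one_le_ν
  have hm3r : (3 : ℝ) ≤ m := by linarith
  have hm3 : 3 ≤ m := by exact_mod_cast hm3r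
  have hm1 : 1 ≤ m := by omega
  have hm2 : 2 ≤ m := by omega
  set n := fineN m ρ with hn
  have hn1 : 1 ≤ n := by rw [hn, fineN]; omega
  have hn0 : (0 : ℝ) < n := by exact_mod_cast hn1
  have hnd : (1 : ℝ) ≤ (n : ℝ) ^ d := one_le_pow₀ (by exact_mod_cast hn1)
  set r := β ^ (-(2 / 5 : ℝ)) with hr
  have hr0 : 0 < r := Real.rpow_pos_of_pos hβ0 _
  have hβ10 : 0 < β ^ (1 / 10 : ℝ) := Real.rpow_pos_of_pos hβ0 _
  set η : ℝ := ((n : ℝ) ^ d)⁻¹ with hηdef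
  have hη0 : 0 < η := by rw [hηdef]; positivity
  have hη1 : η ≤ 1 := inv_le_one_of_one_le₀ hnd
  have hR'1 : 1 ≤ Real.sqrt β * r / B.ν := by
    rw [hr, B.Rprime_eq hβ0, le_div_iff₀ hN0, one_mul]; exact hN10
  have hη : η ≤ Real.sqrt β * r / B.ν := hη1.trans hR'1
  have hRble : Rbfun d (bL d) β ≤ β ^ (1 / 10 : ℝ) / B.ν := by
    rw [div_le_iff₀ hβ10] at hRb; rw [div_eq_mul_one_div, mul_comm]; exact hRb
  have hR : R0 d m η ≤ Real.sqrt β * r / B.ν := by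
    rw [hr, B.Rprime_eq hβ0]
    exact (R0_le_Rbfun (d := d) hd hβ1 hm1 hmb hη0 hη1).trans hRble
  have h := B.G_sub_le_T_special hβ2 hd hm2 hρ hr0 hr1 hη hR
  have hc := B.common_err_le hβ0 hr1 n
  rw [← hr] at hc
  -- the Theorem-14.3 error is at most `errLB`
  have hm1r : β ^ bL d / 2 ≤ (m : ℝ) - 1 := by linarith
  have hm1pos : (0 : ℝ) < (m : ℝ) - 1 := by linarith
  have hbpos : 0 < β ^ bL d := by linarith
  have hinv : 1 / ((m : ℝ) - 1) ≤ 2 / β ^ bL d := by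
    rw [div_le_div_iff₀ hm1pos hbpos]; linarith
  have hB := Bcost_le_Bbar (d := d) hβ1 hn1 hn3
  have hB0 := Bcost_nonneg (d := d) hd hn1
  have hlog2 : 0 < Real.log 2 := Real.log_pos one_lt_two
  have t1 : Real.log 2 / ((m : ℝ) - 1) ^ d ≤ 2 * Real.log 2 / β ^ bL d := by
    have hpow : (m : ℝ) - 1 ≤ ((m : ℝ) - 1) ^ d := by
      calc (m : ℝ) - 1 = ((m : ℝ) - 1) ^ 1 := (pow_one _).symm
        _ ≤ ((m : ℝ) - 1) ^ d := pow_le_pow_right₀ (by linarith) hd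
    calc Real.log 2 / ((m : ℝ) - 1) ^ d ≤ Real.log 2 / ((m : ℝ) - 1) :=
          div_le_div_of_nonneg_left hlog2.le hm1pos hpow
      _ = Real.log 2 * (1 / ((m : ℝ) - 1)) := by ring
      _ ≤ Real.log 2 * (2 / β ^ bL d) := by gcongr
      _ = 2 * Real.log 2 / β ^ bL d := by ring
  have t2 : 4 * (d : ℝ) ^ 2 / ((m : ℝ) - 1) * Bcost d n ≤ 8 * (d : ℝ) ^ 2 * Bbar d β / β ^ bL d := by
    calc 4 * (d : ℝ) ^ 2 / ((m : ℝ) - 1) * Bcost d n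
        = 4 * (d : ℝ) ^ 2 * (1 / ((m : ℝ) - 1)) * Bcost d n := by ring
      _ ≤ 4 * (d : ℝ) ^ 2 * (2 / β ^ bL d) * Bbar d β := by gcongr
      _ = 8 * (d : ℝ) ^ 2 * Bbar d β / β ^ bL d := by ring
  have hN2 : (0 : ℝ) ≤ (B.D : ℝ) := Nat.cast_nonneg _
  have t3 : (B.D : ℝ) * (Real.log 2 / ((m : ℝ) - 1) ^ d + 4 * (d : ℝ) ^ 2 / ((m : ℝ) - 1) * Bcost d n) ≤
      B.errLB β := by
    unfold OneBoxBounds.errLB; exact mul_le_mul_of_nonneg_left (add_le_add t1 t2) hN2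
  linarith

/-- **Regime C (`β^c < n ≤ β³`)**: round `n` up to the next special side length `n' = ρ(m-1)+1`
(`m = ⌊β^b⌋`), losing `K₃((n'-n)/n) log β ≤ K₃ β^{b-c} log β`. [cite: arXiv160201222, Lemma 17.7 (proof)] -/
theorem lowC (hd : 1 ≤ d) {β : ℝ} (hβ2 : 2 ≤ β) (hr1 : β ^ (-(2 / 5 : ℝ)) ≤ B.r₁)
    (hN10 : B.ν ≤ β ^ (1 / 10 : ℝ)) (hRb : Rbfun d (bL d) β / β ^ (1 / 10 : ℝ) ≤ 1 / B.ν)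
    (hb4 : 4 ≤ β ^ bL d) {A₁ : ℝ} {n : ℕ} (hnc : β ^ cL d < n) (hn3 : (n : ℝ) ≤ β ^ 3)
    (hGge : ∀ n' : ℕ, n ≤ n' → A₁ ≤ B.Gm n') :
    A₁ - B.e0 β - B.errLB β - B.K₃ * (β ^ bL d / β ^ cL d * Real.log β) ≤ B.T n β := by
  have hβ0 : 0 < β := by linarith
  have hβ1 : 1 ≤ β := by linarith
  have hL0 : 0 ≤ Real.log β := Real.log_nonneg hβ1
  have hbc : β ^ bL d ≤ β ^ cL d := Real.rpow_le_rpow_of_exponent_le hβ1 (bL_lt_cL (d := d)).le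
  have hc1 : 1 ≤ β ^ cL d := Real.one_le_rpow hβ1 (cL_pos (d := d)).le
  obtain ⟨hmb, hmb'⟩ := floor_scale (Real.rpow_nonneg hβ0.le (bL d))
  set m := ⌊β ^ bL d⌋₊ with hm
  have hm3r : (3 : ℝ) ≤ m := by linarith
  have hm3 : 3 ≤ m := by exact_mod_cast hm3r
  have hn1r : (1 : ℝ) < n := lt_of_le_of_lt hc1 hnc
  have hn2 : 2 ≤ n := by
    have : (1 : ℕ) < n := by exact_mod_cast hn1r
    omega
  have hn1 : 1 ≤ n := by omega
  have hn0 : (0 : ℝ) < n := by positivity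
  have hmn : m ≤ n := by
    have : (m : ℝ) ≤ n := by linarith
    exact_mod_cast this
  -- the special side length `n' = ρ(m-1)+1 ∈ [n, n+m-1]`
  set ρ : ℕ := (n - 1) / (m - 1) + 1 with hρ
  have hρ1 : 1 ≤ ρ := Nat.le_add_left 1 _
  set n' := fineN m ρ with hn'
  have hdiv := Nat.lt_div_mul_add (a := n - 1) (b := m - 1) (by omega)
  have hdiv2 := Nat.div_mul_le_self (n - 1) (m - 1)
  have hnn' : n ≤ n' := by
    have : n - 1 < ρ * (m - 1) := by rw [hρ, Nat.add_mul, one_mul]; exact hdiv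
    have hn'eq : n' = ρ * (m - 1) + 1 := rfl
    omega
  have hn'le : n' ≤ n + m - 1 := by
    have : ρ * (m - 1) ≤ (n - 1) + (m - 1) := by
      rw [hρ, Nat.add_mul, one_mul]; exact Nat.add_le_add_right hdiv2 _
    have hn'eq : n' = ρ * (m - 1) + 1 := rfl
    omega
  have hn'2n : n' ≤ 2 * n := by omega
  have hn'3 : (n' : ℝ) ≤ 3 * β ^ 3 := by
    have : (n' : ℝ) ≤ 2 * n := by exact_mod_cast hn'2n
    nlinarith [Real.rpow_nonneg hβ0.le (3 : ℝ), show (0:ℝ) ≤ β ^ 3 by positivity]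
  -- regime B at `n'`
  have hB := B.lowB hd hβ2 hr1 hN10 hRb hb4 hmb hmb' hρ1 hn'3
  -- rounding loss
  have hround := B.T_sub_le_T_of_le hd hβ2 hn1 hnn' hn'2n
  have hfrac : ((n' : ℝ) - n) / n ≤ β ^ bL d / β ^ cL d := by
    have h1 : (n' : ℝ) - n ≤ β ^ bL d := by
      have : (n' : ℝ) ≤ n + m - 1 := by
        have h := hn'le
        have : ((n + m - 1 : ℕ) : ℝ) = (n : ℝ) + m - 1 := by
          rw [Nat.cast_sub (by omega)]; push_cast; ring
        rw [← this]; exact_mod_cast h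
      linarith
    have h0 : 0 ≤ (n' : ℝ) - n := sub_nonneg.2 (by exact_mod_cast hnn')
    calc ((n' : ℝ) - n) / n ≤ β ^ bL d / n := div_le_div_of_nonneg_right h1 hn0.le
      _ ≤ β ^ bL d / β ^ cL d := div_le_div_of_nonneg_left (by linarith) (by linarith) hnc.le
  have hK := B.K₃_nonneg
  have hloss : B.K₃ * (((n' : ℝ) - n) / n) * Real.log β ≤ B.K₃ * (β ^ bL d / β ^ cL d * Real.log β) := by
    rw [mul_assoc]; exact mul_le_mul_of_nonneg_left (mul_le_mul_of_nonneg_right hfrac hL0) hK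
  have hG := hGge n' hnn'
  linarith

/-- The descent junk is at most `J_D(β)` when `β² ≤ s ≤ 3β^{2+b}` and `n > β³`. [folklore] -/
theorem descent_junk_le_JD {β : ℝ} (hβ2 : 2 ≤ β) {s n : ℝ} (hs : β ^ 2 ≤ s)
    (hsle : s ≤ 3 * β ^ (2 + bL d)) (hn : β ^ 3 < n) :
    (((d : ℝ) / s + d * 2 ^ (d - 1) * (s / n)) * (B.Kc + d * (B.D : ℝ) / 2) +
        ((d : ℝ) + 1) * (B.D : ℝ) / s) * Real.log β +
      2 ^ d * ((d : ℝ) + 2) * B.P₅ * (d : ℝ) ^ 2 * β / s ≤ B.JD β := by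
  have hβ0 : 0 < β := by linarith
  have hL0 : 0 ≤ Real.log β := Real.log_nonneg (by linarith)
  have hβsq : 0 < β ^ 2 := by positivity
  have hs0 : 0 < s := lt_of_lt_of_le hβsq hs
  have hn0 : 0 < n := lt_trans (by positivity) hn
  have hP := B.P₅_nonneg
  have hD : (0 : ℝ) ≤ (B.D : ℝ) := Nat.cast_nonneg _
  have hpow2b : β ^ 2 * β ^ bL d = β ^ (2 + bL d) := by rw [Real.rpow_add hβ0, Real.rpow_two]
  have hK0 : 0 ≤ B.Kc + d * (B.D : ℝ) / 2 := by have := B.Kc_nonneg; positivity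
  have j1 : (d : ℝ) / s ≤ d / β ^ 2 := div_le_div_of_nonneg_left (Nat.cast_nonneg d) hβsq hs
  have j2 : s / n ≤ 3 * (β ^ bL d / β) := by
    rw [div_le_iff₀ hn0]
    have e : 3 * (β ^ bL d / β) * β ^ 3 = 3 * β ^ (2 + bL d) := by rw [← hpow2b]; field_simp
    have hc : 0 ≤ 3 * (β ^ bL d / β) := by positivity
    have := mul_le_mul_of_nonneg_left hn.le hc
    linarith
  have j3 : ((d : ℝ) + 1) * (B.D : ℝ) / s ≤ ((d : ℝ) + 1) * (B.D : ℝ) * (1 / β ^ 2) := by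
    rw [mul_one_div]; exact div_le_div_of_nonneg_left (by positivity) hβsq hs
  have j4 : 2 ^ d * ((d : ℝ) + 2) * B.P₅ * (d : ℝ) ^ 2 * β / s ≤
      2 ^ d * ((d : ℝ) + 2) * B.P₅ * (d : ℝ) ^ 2 / β := by
    rw [div_le_div_iff₀ hs0 hβ0]
    have hc : 0 ≤ 2 ^ d * ((d : ℝ) + 2) * B.P₅ * (d : ℝ) ^ 2 * β := by positivity
    have := mul_le_mul_of_nonneg_left hs hc
    have e : β ^ 2 = β * β := sq β
    nlinarith
  have jy : (d : ℝ) / s + d * 2 ^ (d - 1) * (s / n) ≤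
      (d : ℝ) / β ^ 2 + 3 * d * 2 ^ (d - 1) * (β ^ bL d / β) := by
    have : (d : ℝ) * 2 ^ (d - 1) * (s / n) ≤ d * 2 ^ (d - 1) * (3 * (β ^ bL d / β)) := by gcongr
    linarith
  have p1 := mul_le_mul_of_nonneg_right jy hK0
  have p2 := mul_le_mul_of_nonneg_right (add_le_add p1 j3) hL0
  have eJ : B.JD β = (((d : ℝ) / β ^ 2 + 3 * d * 2 ^ (d - 1) * (β ^ bL d / β)) *
      (B.Kc + d * (B.D : ℝ) / 2) + ((d : ℝ) + 1) * (B.D : ℝ) * (1 / β ^ 2)) * Real.log β +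
      2 ^ d * ((d : ℝ) + 2) * B.P₅ * (d : ℝ) ^ 2 / β := by
    unfold OneBoxBounds.JD; ring
  rw [eJ]
  exact add_le_add p2 j4

/-- **Regime D (`n > β³`)**: descend (Lemma 17.5) to the special side length `n'' = ⌈β²⌉(m-1)+1`,
losing `J_D(β)`. [cite: arXiv160201222, Lemma 17.7 (proof)] -/
theorem lowD (hd : 1 ≤ d) {β : ℝ} (hβ2 : 2 ≤ β) (hr1 : β ^ (-(2 / 5 : ℝ)) ≤ B.r₁)
    (hN10 : B.ν ≤ β ^ (1 / 10 : ℝ)) (hRb : Rbfun d (bL d) β / β ^ (1 / 10 : ℝ) ≤ 1 / B.ν)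
    (hb4 : 4 ≤ β ^ bL d) (h4 : 4 ≤ β ^ (1 - bL d)) {A₁ : ℝ} {n : ℕ} (hn3 : β ^ 3 < n)
    (hGge : ∀ n' : ℕ, β ≤ n' → A₁ ≤ B.Gm n') :
    A₁ - B.e0 β - B.errLB β - B.JD β ≤ B.T n β := by
  have hβ0 : 0 < β := by linarith
  have hβ1 : 1 ≤ β := by linarith
  obtain ⟨hmb, hmb'⟩ := floor_scale (Real.rpow_nonneg hβ0.le (bL d))
  obtain ⟨hρ1, hsge, hsle, h3cube⟩ := nD_size (d := d) hβ2 hb4 h4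
  set m := ⌊β ^ bL d⌋₊ with hm
  set ρ : ℕ := ⌈β ^ 2⌉₊ with hρ
  set n'' := fineN m ρ with hn''
  have hm3r : (3 : ℝ) ≤ m := by linarith
  have hm3 : 3 ≤ m := by exact_mod_cast hm3r
  have hn''1 : 1 ≤ n'' := by rw [hn'', fineN]; omega
  have hsn : n'' + 1 ≤ n := by
    have : (n'' : ℝ) + 1 < n := by linarith
    exact_mod_cast this.le
  have hn''3 : (n'' : ℝ) ≤ 3 * β ^ 3 := by nlinarith [show (0:ℝ) ≤ β ^ 3 by positivity]
  have hB := B.lowB hd hβ2 hr1 hN10 hRb hb4 hmb hmb' hρ1 hn''3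
  have hdesc := B.T_sub_le_T_of_ge hβ2 hd hn''1 hsn
  have hjunk := B.descent_junk_le_JD hβ2 hsge hsle hn3
  have hβn'' : β ≤ n'' := by nlinarith
  have hG := hGge n'' hβn''
  linarith

/-! ### Lemma 17.7: the lower bound for the joint limit -/

/-- **Lemma 17.7 (the lower bound, joint in `n` and `β`)**: if `G(n) → A₀` then for every `ε > 0`,
eventually as `(n, β) → (∞, ∞)`, `T(B_n, β) ≥ A₀ - ε`; by the three regimes `n ≤ β^c` (`lowA`),
`β^c < n ≤ β³` (`lowC`) and `n > β³` (`lowD`). [cite: arXiv160201222, Lemma 17.7] -/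
theorem eventually_le_T (hd : 2 ≤ d) {A₀ : ℝ} (hG : Tendsto B.Gm atTop (𝓝 A₀))
    {ε : ℝ} (hε : 0 < ε) :
    ∀ᶠ p : ℕ × ℝ in atTop ×ˢ atTop, A₀ - ε ≤ B.T p.1 p.2 := by
  have hd1 : 1 ≤ d := by omega
  have hN0 : (0 : ℝ) < B.ν := lt_of_lt_of_le one_pos B.one_le_ν
  have hr₁ := B.r₁_pos
  -- Step 1: threshold in `n`
  have hev_m : ∀ᶠ m : ℕ in atTop, A₀ - ε / 8 ≤ B.Gm m ∧
      (B.D : ℝ) * (Real.log 2 / (m : ℝ) ^ d) ≤ ε / 8 := by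
    have h1 : ∀ᶠ m : ℕ in atTop, A₀ - ε / 8 ≤ B.Gm m :=
      hG.eventually (le_mem_nhds (by linarith : A₀ - ε / 8 < A₀))
    have h2 : Tendsto (fun m : ℕ => (B.D : ℝ) * (Real.log 2 / (m : ℝ) ^ d)) atTop (𝓝 0) := by
      have := ((tendsto_const_nhds (x := Real.log 2)).div_atTop
        ((tendsto_pow_atTop (n := d) (by omega)).comp tendsto_natCast_atTop_atTop)).const_mul
        (B.D : ℝ)
      simpa using this
    exact h1.and (h2.eventually (ge_mem_nhds (by positivity)))
  obtain ⟨M₀, hM₀⟩ := eventually_atTop.1 hev_m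
  set M := max M₀ 1 with hM
  have hMspec : ∀ m, M ≤ m → A₀ - ε / 8 ≤ B.Gm m ∧ (B.D : ℝ) * (Real.log 2 / (m : ℝ) ^ d) ≤ ε / 8 :=
    fun m hm => hM₀ m ((le_max_left _ _).trans hm)
  have hM1 : 1 ≤ M := le_max_right _ _
  -- Step 2: thresholds in `β`
  have hK3lim : Tendsto (fun β : ℝ => B.K₃ * (β ^ bL d / β ^ cL d * Real.log β)) atTop (𝓝 0) := by
    have h := (tendsto_rpow_mul_log (p := bL d - cL d) (by linarith [bL_lt_cL (d := d)])).const_mul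
      B.K₃
    rw [mul_zero] at h
    refine h.congr' ?_
    filter_upwards [eventually_gt_atTop 0] with β hβ
    rw [Real.rpow_sub hβ]
  have hev_β : ∀ᶠ β : ℝ in atTop, 2 ≤ β ∧ β ^ (-(2 / 5 : ℝ)) ≤ B.r₁ ∧ B.e0 β ≤ ε / 8 ∧
      B.ν ≤ β ^ (1 / 10 : ℝ) ∧ Wfun d (cL d) β / β ^ (1 / 5 : ℝ) ≤ 1 / B.ν ^ 2 ∧
      Rbfun d (bL d) β / β ^ (1 / 10 : ℝ) ≤ 1 / B.ν ∧ 4 ≤ β ^ bL d ∧ B.errLB β ≤ ε / 8 ∧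
      B.K₃ * (β ^ bL d / β ^ cL d * Real.log β) ≤ ε / 8 ∧ (M : ℝ) ≤ β ∧ 4 ≤ β ^ (1 - bL d) ∧
      B.JD β ≤ ε / 8 := by
    refine (eventually_ge_atTop 2).and (Eventually.and ?_ (Eventually.and ?_ (Eventually.and ?_
      (Eventually.and ?_ (Eventually.and ?_ (Eventually.and ?_ (Eventually.and ?_ (Eventually.and ?_
      (Eventually.and ?_ (Eventually.and ?_ ?_))))))))))
    · exact (tendsto_rpow_neg_atTop (by norm_num : (0 : ℝ) < 2 / 5)).eventually (ge_mem_nhds hr₁)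
    · exact B.tendsto_e0.eventually (ge_mem_nhds (by positivity))
    · exact (tendsto_rpow_atTop (by norm_num : (0 : ℝ) < 1 / 10)).eventually_ge_atTop _
    · exact (tendsto_Wfun_div (d := d) cL_mul_lt).eventually (ge_mem_nhds (by positivity))
    · exact (tendsto_Rbfun_div (d := d) hd1 bL_pos.le bL_mul_lt).eventually
        (ge_mem_nhds (by positivity))
    · exact (tendsto_rpow_atTop (bL_pos (d := d))).eventually_ge_atTop _
    · exact B.tendsto_errLB.eventually (ge_mem_nhds (by positivity))
    · exact hK3lim.eventually (ge_mem_nhds (by positivity))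
    · exact eventually_ge_atTop _
    · exact (tendsto_rpow_atTop (by linarith [bL_lt_one (d := d)] : (0 : ℝ) < 1 - bL d)).eventually_ge_atTop _
    · exact B.tendsto_JD.eventually (ge_mem_nhds (by positivity))
  -- Step 3: the pointwise argument
  refine ((eventually_ge_atTop M).prod_mk hev_β).mono ?_
  rintro ⟨n, β⟩ ⟨hn, c1, c2, c3, c4, c5, c6, c7, c8, c9, c10, c11, c12⟩
  dsimp only at hn c1 c2 c3 c4 c5 c6 c7 c8 c9 c10 c11 c12 ⊢
  have hn1 : 1 ≤ n := hM1.trans hn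
  by_cases hA : (n : ℝ) ≤ β ^ cL d
  · have h := B.lowA hd1 c1 c2 c5 hn1 hA
    obtain ⟨hGn, hlogn⟩ := hMspec n hn
    linarith
  · push Not at hA
    by_cases hC : (n : ℝ) ≤ β ^ 3
    · have h := B.lowC hd1 c1 c2 c4 c6 c7 (A₁ := A₀ - ε / 8) hA hC
        (fun n' hnn' => (hMspec n' (hn.trans hnn')).1)
      linarith
    · push Not at hC
      have h := B.lowD hd1 c1 c2 c4 c6 c7 c11 (A₁ := A₀ - ε / 8) hC
        (fun n' hβn' => (hMspec n' (by
          have : (M : ℝ) ≤ n' := c10.trans hβn'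
          exact_mod_cast this)).1)
      linarith

/-- **The joint limit of the normalised free energy** (Lemmas 17.4 and 17.7): if `G(n) → A₀` then
`T(B_n, β) → A₀` as `n → ∞` and `β → ∞` jointly. [cite: arXiv160201222, §17 (proof of Thm. 2.1)] -/
theorem tendsto_T (hd : 2 ≤ d) {A₀ : ℝ} (hG : Tendsto B.Gm atTop (𝓝 A₀)) :
    Tendsto (fun p : ℕ × ℝ => B.T p.1 p.2) (atTop ×ˢ atTop) (𝓝 A₀) := by
  rw [Metric.tendsto_nhds]
  intro ε hε
  filter_upwards [B.eventually_T_le hd hG (half_pos hε), B.eventually_le_T hd hG (half_pos hε)]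
    with p h1 h2
  rw [Real.dist_eq, abs_lt]
  constructor <;> linarith

/-- **The main term**: if `log Z_M(B_n)/n^d → L` (Theorem 15.2) then
`G(n) → (d-1) log c_H + D L`. [cite: arXiv160201222, §17 (proof of Thm. 2.1)] -/
theorem tendsto_Gm (hd : 1 ≤ d) {L : ℝ}
    (hL : Tendsto (fun n : ℕ => logZM d n / (n : ℝ) ^ d) atTop (𝓝 L)) :
    Tendsto B.Gm atTop (𝓝 (((d : ℝ) - 1) * Real.log B.cH + (B.D : ℝ) * L)) :=
  ((tendsto_coef hd).mul_const _).add (hL.const_mul _)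

end OneBoxBounds

/-- **STUB 1 — the abstract joint limit (Chatterjee §17, Lemmas 17.1–17.7, group-free).** From the
one-box interface `B : OneBoxBounds d` and the existence of the lattice Maxwell free energy per site
(`log Z_M(B_n)/n^d → L`, Theorem 15.2, in tree), jointly as `n → ∞`, `β → ∞`:
`T(B_n, β) = log Z(B_n,β)/n^d + (|E_n^1|/(2n^d)) D log β → (d−1) log c_H + D L`. [cite: arXiv160201222, §17 (proof of Thm. 2.1)] -/
theorem stub_abstractJointLimit {d : ℕ} (hd : 2 ≤ d) (B : OneBoxBounds d) {L : ℝ}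
    (hL : Tendsto (fun n : ℕ => ChatterjeeAssembly.logZM d n / (n : ℝ) ^ d) atTop (𝓝 L)) :
    Tendsto (fun p : ℕ × ℝ => B.T p.1 p.2) (atTop ×ˢ atTop)
      (𝓝 (((d : ℝ) - 1) * Real.log B.cH + (B.D : ℝ) * L)) :=
  B.tendsto_T hd (B.tendsto_Gm (by omega) hL)

end Summit.QuantumFields.YangMills.Theorems.FreeEnergyLogCoefficient

end
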